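import Literature.NumberTheory.Automorphic.CentralizerBorel
import Literature.NumberTheory.Automorphic.RootSubgroupProofs
import HarnessLib

/-!
# Uniqueness of root subgroups (Springer 8.1.1 (i)): reduction to semisimple rank one

Springer, *Linear Algebraic Groups* (2nd ed.), 8.1.1 (i), proof: "*`G_α` is connected, reductive,
with maximal torus `T` (7.1.3) … it suffices to prove 8.1.1 for `G_α`*", where
`G_α = Z_G((Ker α)°)`. Combining the assembly `rootSubgroup_unique_of_facts`
(`RootSubgroupProofs.lean`) with the theorems now in the tree — `Z_G(S)°` connected reductive
(`isConnectedReductive_identityComponent_centralizer`, 7.6.4 (i) for the identity component,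
`CentralizerBorel.lean`) and 6.4.8 (ii) (`centralizer_le_of_isBorelIn_holds`,
`LowestWeightBorel.lean`, giving `atMostTwo_isBorelIn_of_central`) — the named fact
`rootSubgroup_unique` is reduced to the single rank-one input
`exists_rootHom_sup_isBorelIn_of_central` (7.3.3 (ii)): `rootSubgroup_unique_of_rankOne`. The
reduction runs inside `G_α° = Z_G((Ker α)°)°` instead of `G_α` (so that 6.4.7 (i) is not
needed): `T` and the images of root homomorphisms for `α`, being Zariski-connected subgroups of
`G_α`, lie in `G_α°`.

## References

* T. A. Springer, *Linear Algebraic Groups*, 2nd ed., Progress in Mathematics 9, Birkhäuser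
  (1998), 7.1.3, 7.6.4, 8.1.1 [SpringerLAG1998].
-/

noncomputable section

open Matrix

namespace Literature.NumberTheory.Automorphic

variable {k : Type*} [Field k] {n : Type*} [Fintype n] [DecidableEq n]

section Assembly

variable {G T : Subgroup (GL n k)}

/-- **Springer 8.1.1 (i), uniqueness of root subgroups, from the rank-one input alone.** The
named fact `rootSubgroup_unique` follows from `exists_rootHom_sup_isBorelIn_of_central`
(7.3.3 (ii): the Borel subgroups `T · U_{±α}` in semisimple rank one): the singular torus
`S = (Ker α)°` has `G_α° = Z_G(S)°` connected reductive
(`isConnectedReductive_identityComponent_centralizer`) with maximal torus `T` and central `S`;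
root homomorphisms for `α` land in `G_α°` (their images are Zariski-connected and centralise
`Ker α`); and in `G_α°` at most two Borel subgroups contain `T`
(`atMostTwo_isBorelIn_of_central_of_centralizer_le centralizer_le_of_isBorelIn_holds`), so
`IsRootHom.map_range_eq_of_central` applies. [cite: SpringerLAG1998, 8.1.1 (i), proof] -/
theorem rootSubgroup_unique_of_rankOne
    (hC₂ : exists_rootHom_sup_isBorelIn_of_central (k := k) (n := n)) :
    rootSubgroup_unique (G := G) (T := T) := by
  refine rootSubgroup_unique_iff_range_eq.2 fun hG hT α hα u u' hu hu' => ?_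
  -- the singular subtorus `S = (Ker α)°`, `G_α = Z_G(S)` and `G_α°`
  set K : Subgroup (GL n k) := (α : ↥T →* kˣ).ker.map T.subtype with hK
  set S : Subgroup (GL n k) := identityComponent K with hS
  set Gα : Subgroup (GL n k) := G ⊓ Subgroup.centralizer (S : Set (GL n k)) with hGα
  set Gα₀ : Subgroup (GL n k) := identityComponent Gα with hGα₀
  have hTtorus : IsTorusSubgroup T := hT.2.1
  haveI : IsMulCommutative ↥T := hTtorus.2.1
  have hKalg : IsAlgebraicSubgroup K := isAlgebraicSubgroup_map_ker hTtorus.1.1 α.2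
  have hKT : K ≤ T := Subgroup.map_subtype_le _
  have hStorus : IsTorusSubgroup S := isTorusSubgroup_identityComponent hTtorus hKalg hKT
  have hST : S ≤ T := (identityComponent_le K).trans hKT
  have hGαalg : IsAlgebraicSubgroup Gα := hG.1.1.inf (isAlgebraicSubgroup_centralizer_set _)
  have hGα₀red : IsConnectedReductive Gα₀ :=
    isConnectedReductive_identityComponent_centralizer hG hStorus (hST.trans hT.1)
  have hGα₀G : Gα₀ ≤ G := (identityComponent_le _).trans inf_le_left
  -- `T` is a maximal torus of `G_α°`
  have hTGα : T ≤ Gα := by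
    refine le_inf hT.1 fun t ht => Subgroup.mem_centralizer_iff.2 fun s hs => ?_
    exact congrArg Subtype.val (IsMulCommutative.is_comm.comm (⟨s, hST hs⟩ : ↥T) ⟨t, ht⟩)
  have hTGα₀ : T ≤ Gα₀ :=
    hTtorus.1.le_of_finiteIndex hTGα (isAlgebraicSubgroup_identityComponent hGαalg)
      (finiteIndex_identityComponent hGαalg)
  have hTmax : IsMaximalTorusIn T Gα₀ :=
    ⟨hTGα₀, hTtorus, fun T' h₁ h₂ h₃ => hT.2.2 T' h₁ (h₂.trans hGα₀G) h₃⟩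
  -- root homomorphisms for `α` land in `G_α°`
  have hmem : ∀ {v : Multiplicative k →* ↥G}, IsRootHom G T hT.1 α v →
      ∀ x, (G.subtype.comp v) x ∈ Gα₀ := by
    intro v hv x
    have h1 : v.range.map G.subtype ≤ Gα := by
      refine le_inf ?_ (hv.map_range_le_centralizer.trans
        (Subgroup.centralizer_le (identityComponent_le K)))
      rintro _ ⟨y, -, rfl⟩
      exact y.2
    have h2 : v.range.map G.subtype ≤ Gα₀ :=
      (hv.isZConnected_map_range hG.1.1).le_of_finiteIndex h1
        (isAlgebraicSubgroup_identityComponent hGαalg) (finiteIndex_identityComponent hGαalg)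
    exact h2 ⟨v x, ⟨x, rfl⟩, rfl⟩
  have huα := hu.codRestrict hTGα₀ (hmem hu)
  have hu'α := hu'.codRestrict hTGα₀ (hmem hu')
  have hαroot : α ∈ roots Gα₀ T := ⟨hα.1, hTGα₀, _, huα⟩
  have hcen : Gα₀ ≤ Subgroup.centralizer
      ((identityComponent ((α : ↥T →* kˣ).ker.map T.subtype) : Subgroup (GL n k)) :
        Set (GL n k)) := (identityComponent_le _).trans inf_le_right
  have key := IsRootHom.map_range_eq_of_central
    (atMostTwo_isBorelIn_of_central_of_centralizer_le centralizer_le_of_isBorelIn_holds) hC₂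
    hGα₀red hTmax hαroot hcen huα hu'α
  rw [map_range_codRestrict, map_range_codRestrict] at key
  exact Subgroup.map_injective G.subtype_injective key

end Assembly

end Literature.NumberTheory.Automorphic
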